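import Summits.BirchSwinnertonDyer.BirchSwinnertonDyer.Theorems.ResidualThetaTransportAtTwoThetaTransportResidualUnramified
import Literature.NumberTheory.EllipticCurves.Kobayashi2003.SignedSelmer
import Literature.NumberTheory.GaloisRepresentations.ContinuousH1CoefficientTransport
import HarnessLib

/-!
# Transport of the Kummer condition at `2` along `Θ ∘ j` (crux (R≥)ᵖ, stub `stub_transport` v2, the condition at `2`)

Route `ResidualThetaTransportAtTwo` (RTT), crux (R≥)ᵖ `ResidualThetaCountLowerPureAtTwo` (stmt-BirchSwinnertonDyer-26074),
line «bt26-lambda» v2; seat `prover-bsd-wall-rtt-p2` g12 (`--supports`, closes nothing). HONEST FRAMING: THEOREMS ONLY (no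
definition, no named fact, no instance, no `sorry`); a piece of Galois-cohomological bookkeeping; BSD is not proved by any of this.

WHAT. In `stub_transport` v2 the `g`-side local condition at `v ∣ 2` on a class `y ∈ H¹(H, A_g)` (`H = Γ_{ℚ_∞}`) is the
TRANSPORTED Kummer condition: `y = [φ]` with `Θ(φ(τ))_i = τ Q_i − Q_i` on the local group, `2ᵏ Q_i ∈ E⁺`, where
`Θ : A_g ≃ (W[2^∞])ⁿ` is the local identification of the θ-datum; the `W`-side condition on `z ∈ H¹(H, V₂)` (`V₂ = (W[2^∞])[2]`)
is Kobayashi's `localKummerOverOfEmb` on the pushed class in `H¹(H, W[2^∞])`. For `y = j_* x` (`j : V₂^f ↪ A_g` the residual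
isomorphism) the two agree coordinatewise PROVIDED `Θ ∘ j` is a matrix of integers `B` on coordinates with a left inverse
`B'` modulo `2` (which the local Schur lemma supplies, file `…ResidualSchurAtTwo`):
* `kummer_transport_iff` — `(∃ φ Q k, [φ] = j_* x ∧ 2ᵏQ ∈ L ∧ Θ-Kummer identity) ↔ ∀ l, (e x l pushed to W[2^∞]) ∈ localKummerOverOfEmb L`
  for any coordinate system `e : H¹(H, V₂^f) ≃ H¹(H, V₂)^f` computed on cocycles (`…ResidualCoordinates.exists_coordEquiv` (i));
* `kummer_transport_conj_iff` — the same with `conj_σ` on both sides (the clause as printed in the crux).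
Proof: change representatives by coboundaries (`oneCocycleClass_eq_zero_iff`), read `Θ` through `B` / `B'`, and use that the
values of `V₂`-cocycles are `2`-torsion (so only `B'B mod 2` matters); torsion translates `Θ(a)` are absorbed into `Q`.

References: [Kobayashi2003] Def. 1.1; [SerreGaloisCohomology1997] I §2.2, I §2.4, I §5.1; [GreenbergVatsal2000] §2 p. 28.
-/

set_option autoImplicit false
-- the Theorems namespace of this sub repeats the summit name by design (D-0017 nested layout)
set_option linter.dupNamespace false

noncomputable section

open scoped AddSubgroup
open WeierstrassCurve Field Literature Literature.NumberTheory.EllipticCurves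
  Literature.NumberTheory.EllipticCurves.GreenbergVatsal2000 Literature.NumberTheory.GaloisRepresentations

namespace Summit.BirchSwinnertonDyer.BirchSwinnertonDyer.Theorems.ThetaTransport

/-! ### §1. Small algebra -/

section Algebra

variable {G M : Type*} [Monoid G] [AddCommGroup M] [DistribMulAction G M]

/-- `τ(∑ cᵢRᵢ) − ∑ cᵢRᵢ = ∑ cᵢ(τRᵢ − Rᵢ)`. [folklore] -/
theorem smul_sum_nsmul_sub {ι : Type*} (s : Finset ι) (τ : G) (c : ι → ℕ) (R : ι → M) :
    τ • (∑ i ∈ s, c i • R i) - ∑ i ∈ s, c i • R i = ∑ i ∈ s, c i • (τ • R i - R i) := by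
  rw [Finset.smul_sum, ← Finset.sum_sub_distrib]
  refine Finset.sum_congr rfl fun i _ ↦ ?_
  rw [smul_sub, smul_comm]

omit [Monoid G] [DistribMulAction G M] in
/-- `∑ᵢ cᵢ ∑ₗ dᵢₗ pₗ = ∑ₗ (∑ᵢ cᵢ dᵢₗ) pₗ`. [folklore] -/
theorem sum_nsmul_sum_nsmul {ι κ : Type*} (s : Finset ι) (t : Finset κ) (c : ι → ℕ) (d : ι → κ → ℕ) (p : κ → M) :
    ∑ i ∈ s, c i • ∑ l ∈ t, d i l • p l = ∑ l ∈ t, (∑ i ∈ s, c i * d i l) • p l := by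
  simp_rw [Finset.smul_sum, smul_smul, Finset.sum_smul]
  rw [Finset.sum_comm]

omit [Monoid G] [DistribMulAction G M] in
/-- On a `2`-torsion element only the parity of an integer multiplier matters. [folklore] -/
theorem nsmul_eq_nsmul_of_mod_two_eq {P : M} (hP : 2 • P = 0) {a b : ℕ} (h : a % 2 = b % 2) : a • P = b • P := by
  rw [← Nat.div_add_mod a 2, ← Nat.div_add_mod b 2, h, add_smul, add_smul, mul_comm, mul_smul, hP, smul_zero,
    mul_comm, mul_smul, hP, smul_zero]

end Algebra

/-! ### §2. Torsion exponents -/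

section Torsion

variable {M : Type*} [AddCommGroup M]

/-- `2ᵏQ ∈ L ⇒ 2ᴷQ ∈ L` for `k ≤ K`. [folklore] -/
theorem pow_nsmul_mem_of_le (L : AddSubgroup M) {Q : M} {k K : ℕ} (hQ : (2 ^ k) • Q ∈ L) (hk : k ≤ K) :
    (2 ^ K) • Q ∈ L := by
  rw [← Nat.sub_add_cancel hk, pow_add, mul_smul]
  exact L.nsmul_mem hQ _

/-- `2ᵐT = 0 ⇒ 2ᴷT = 0` for `m ≤ K`. [folklore] -/
theorem pow_nsmul_eq_zero_of_le {T : M} {m K : ℕ} (hT : (2 ^ m) • T = 0) (hm : m ≤ K) : (2 ^ K) • T = 0 := by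
  rw [← Nat.sub_add_cancel hm, pow_add, mul_smul, hT, smul_zero]

variable {K : Type} [Field K] (W : WeierstrassCurve K)

/-- Finitely many points of `W[2^∞]` are killed by a common power of `2`. [folklore] -/
theorem exists_pow_nsmul_eq_zero {ι : Type} [Fintype ι] (t : ι → ↥(W.geomPrimaryTorsion 2)) :
    ∃ m : ℕ, ∀ i, (2 ^ m) • t i = 0 := by
  have h : ∀ i, ∃ m : ℕ, (2 ^ m) • t i = 0 := fun i ↦ by
    obtain ⟨m, hm⟩ := (AddCommGroup.mem_primaryComponent).1 (t i).2
    exact ⟨m, Subtype.ext (by rw [AddSubmonoidClass.coe_nsmul]; exact hm)⟩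
  choose m hm using h
  refine ⟨∑ i, m i, fun i ↦ pow_nsmul_eq_zero_of_le (hm i) ?_⟩
  exact Finset.single_le_sum (fun _ _ ↦ Nat.zero_le _) (Finset.mem_univ i)

/-- The image in `E(K̄_E)` of a point of `V₂ = (W[2^∞])[2]` is `2`-torsion. [folklore] -/
theorem two_nsmul_pointsMapOfEmb_torsionBy {E : Type} [Field E] [Algebra K E]
    (emb : AlgebraicClosure K →ₐ[K] AlgebraicClosure E) (P : ↥(AddSubgroup.torsionBy ↥(W.geomPrimaryTorsion 2) (2 : ℤ))) :
    2 • pointsMapOfEmb W emb (((P : ↥(W.geomPrimaryTorsion 2)) : W.geomPoints)) = 0 := by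
  have hP : (2 : ℤ) • (P : ↥(W.geomPrimaryTorsion 2)) = 0 := (Submodule.mem_torsionBy_iff (2 : ℤ) _).1 P.2
  rw [ofNat_zsmul] at hP
  rw [← map_nsmul, ← AddSubmonoidClass.coe_nsmul, hP, ZeroMemClass.coe_zero, map_zero]

end Torsion

/-! ### §3. The transport of the Kummer condition -/

section Transport

variable {K : Type} [Field K] (W : WeierstrassCurve K) (H : Subgroup (absoluteGaloisGroup K))
  {E : Type} [Field E] [Algebra K E] (emb : AlgebraicClosure K →ₐ[K] AlgebraicClosure E)
  (L : AddSubgroup (localPoints W E))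
  {A : Type} [AddCommGroup A] [DistribMulAction (absoluteGaloisGroup K) A] [TopologicalSpace A] [DiscreteTopology A]
  {n f : ℕ} (Θ : A ≃+ (Fin n → ↥(W.geomPrimaryTorsion 2)))
  (j : (Fin f → ↥(AddSubgroup.torsionBy ↥(W.geomPrimaryTorsion 2) (2 : ℤ))) →+ A)
  (B : Fin n → Fin f → ℕ) (B' : Fin f → Fin n → ℕ)
  (e : subgroupH1 H (Fin f → ↥(AddSubgroup.torsionBy ↥(W.geomPrimaryTorsion 2) (2 : ℤ))) ≃+
    (Fin f → subgroupH1 H ↥(AddSubgroup.torsionBy ↥(W.geomPrimaryTorsion 2) (2 : ℤ))))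

/-- **Transport of the Kummer condition at a place above `2` along `Θ ∘ j`.** For `x ∈ H¹(H, V₂^f)`: the transported
condition on `j_* x` (a representative `φ` of `j_* x` with `Θ(φ(τ))_i = τQ_i − Q_i` on the local group `H_E`, `2ᵏQ_i ∈ L`)
holds iff every coordinate class `e x l ∈ H¹(H, V₂)`, pushed to `H¹(H, W[2^∞])`, lies in Kobayashi's `localKummerOverOfEmb L`.
Hypotheses: `Θ` is `Γ_E`-equivariant, `Θ ∘ j` is the integer matrix `B` on coordinates with a left inverse `B'` modulo `2`, and
`e` is computed on cocycles. [cite: Kobayashi2003, Def. 1.1] [cite: SerreGaloisCohomology1997, I §2.2, I §5.1] -/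
theorem kummer_transport_iff
    (hΘ : ∀ (δ : absoluteGaloisGroup E) (m : A) (i : Fin n), Θ (resGalOfEmb emb δ • m) i = resGalOfEmb emb δ • Θ m i)
    (hjsmul : ∀ (σ : absoluteGaloisGroup K) (x : Fin f → ↥(AddSubgroup.torsionBy ↥(W.geomPrimaryTorsion 2) (2 : ℤ))),
      j (σ • x) = σ • j x)
    (hB : ∀ (x : Fin f → ↥(AddSubgroup.torsionBy ↥(W.geomPrimaryTorsion 2) (2 : ℤ))) (i : Fin n),
      Θ (j x) i = ∑ l, B i l • ((x l : ↥(AddSubgroup.torsionBy ↥(W.geomPrimaryTorsion 2) (2 : ℤ))) : ↥(W.geomPrimaryTorsion 2)))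
    (hB' : ∀ l l' : Fin f, (∑ i, B' l i * B i l') % 2 = if l = l' then 1 else 0)
    (hecoc : ∀ (φ : contOneCocycles (discreteTopRep H (Fin f → ↥(AddSubgroup.torsionBy ↥(W.geomPrimaryTorsion 2) (2 : ℤ)))))
      (l : Fin f), ∃ ψ : contOneCocycles (discreteTopRep H ↥(AddSubgroup.torsionBy ↥(W.geomPrimaryTorsion 2) (2 : ℤ))),
        (∀ h, ψ.1 h = φ.1 h l) ∧ e (oneCocycleClass _ φ) l = oneCocycleClass _ ψ)
    (x : subgroupH1 H (Fin f → ↥(AddSubgroup.torsionBy ↥(W.geomPrimaryTorsion 2) (2 : ℤ)))) :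
    (∃ (φ : contOneCocycles (discreteTopRep H A)) (Q : Fin n → localPoints W E) (k : ℕ),
        oneCocycleClass (discreteTopRep H A) φ = pushH1 H j hjsmul x ∧
        (∀ i : Fin n, (2 ^ k) • Q i ∈ L) ∧
        ∀ (τ : localSubgroupOfEmb H emb) (i : Fin n),
          pointsMapOfEmb W emb (((Θ (φ.1 (resGalSubgroupOfEmb H emb τ))) i : ↥(W.geomPrimaryTorsion 2)) : W.geomPoints) =
            (τ : absoluteGaloisGroup E) • Q i - Q i) ↔
      ∀ l : Fin f, pushH1 H (AddSubgroup.torsionBy ↥(W.geomPrimaryTorsion 2) (2 : ℤ)).subtype (fun _ _ ↦ rfl) (e x l) ∈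
        Kobayashi2003.localKummerOverOfEmb W 2 H emb L := by
  obtain ⟨Φ, rfl⟩ := oneCocycleClass_surjective _ x
  -- the local images `p h l` of the coordinate values of `Φ`; they are `2`-torsion
  obtain ⟨p, hp⟩ : ∃ p : H → Fin f → localPoints W E, ∀ h l, p h l = pointsMapOfEmb W emb (((Φ.1 h l :
      ↥(AddSubgroup.torsionBy ↥(W.geomPrimaryTorsion 2) (2 : ℤ))) : ↥(W.geomPrimaryTorsion 2)) : W.geomPoints) :=
    ⟨_, fun _ _ ↦ rfl⟩
  have h2 : ∀ (h : H) (l : Fin f), 2 • p h l = 0 := fun h l ↦ by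
    rw [hp]; exact two_nsmul_pointsMapOfEmb_torsionBy W emb _
  -- `Θ ∘ j` read through `B`, after `pointsMapOfEmb`
  have hBpt : ∀ (h : H) (i : Fin n),
      pointsMapOfEmb W emb ((Θ (j (Φ.1 h)) i : ↥(W.geomPrimaryTorsion 2)) : W.geomPoints) = ∑ l, B i l • p h l := by
    intro h i
    rw [hB, AddSubmonoidClass.coe_finsetSum, map_sum]
    refine Finset.sum_congr rfl fun l _ ↦ ?_
    rw [AddSubmonoidClass.coe_nsmul, map_nsmul, hp]
  -- the local group acts compatibly on `Θ`-coordinates and on local points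
  have hΘτ : ∀ (τ : localSubgroupOfEmb H emb) (a : A) (i : Fin n),
      pointsMapOfEmb W emb ((Θ (((resGalSubgroupOfEmb H emb τ : H) : absoluteGaloisGroup K) • a) i :
        ↥(W.geomPrimaryTorsion 2)) : W.geomPoints) =
        (τ : absoluteGaloisGroup E) • pointsMapOfEmb W emb ((Θ a i : ↥(W.geomPrimaryTorsion 2)) : W.geomPoints) := by
    intro τ a i
    rw [resGalSubgroupOfEmb_apply_coe, hΘ, primaryComponent.coe_smul, pointsMapOfEmb_smul]
  -- likewise on `W[2^∞]` itself
  have hbτ : ∀ (τ : localSubgroupOfEmb H emb) (b : ↥(W.geomPrimaryTorsion 2)),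
      pointsMapOfEmb W emb (((((resGalSubgroupOfEmb H emb τ : H) : absoluteGaloisGroup K) • b :
        ↥(W.geomPrimaryTorsion 2)) : W.geomPoints)) = (τ : absoluteGaloisGroup E) • pointsMapOfEmb W emb (b : W.geomPoints) := by
    intro τ b
    rw [resGalSubgroupOfEmb_apply_coe, primaryComponent.coe_smul, pointsMapOfEmb_smul]
  constructor
  · -- (⇒) from the transported condition on `j_* [Φ]` to the Kummer condition on each coordinate
    rintro ⟨φ, Q, k, hcl, hQ, hτ⟩ l
    obtain ⟨ψ, hψ, he⟩ := hecoc Φ l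
    rw [he, Kobayashi2003.mem_localKummerOverOfEmb_iff]
    -- `φ = j ∘ Φ + ∂a`
    rw [SignedTransportAtTwo.resH1Hom_id_oneCocycleClass, ← sub_eq_zero, ← oneCocycleClass_sub,
      oneCocycleClass_eq_zero_iff] at hcl
    obtain ⟨a, ha⟩ := hcl
    have ha' : ∀ h : H, φ.1 h = j (Φ.1 h) + ((h : absoluteGaloisGroup K) • a - a) := fun h ↦ by
      have := ha h
      change φ.1 h - j (Φ.1 h) = (h : absoluteGaloisGroup K) • a - a at this
      rw [← this, add_sub_cancel]
    obtain ⟨m, hm⟩ := exists_pow_nsmul_eq_zero W (Θ a)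
    -- the torsion translates `T i = Θ(a)ᵢ` in `E(K̄_E)` and the corrected points `Q i − T i`
    obtain ⟨T, hT⟩ : ∃ T : Fin n → localPoints W E,
        ∀ i, T i = pointsMapOfEmb W emb ((Θ a i : ↥(W.geomPrimaryTorsion 2)) : W.geomPoints) := ⟨_, fun _ ↦ rfl⟩
    have hT0 : ∀ i, (2 ^ m) • T i = 0 := fun i ↦ by
      rw [hT, ← map_nsmul, ← AddSubmonoidClass.coe_nsmul, hm, ZeroMemClass.coe_zero, map_zero]
    -- key identity `∑ₗ B i l • p τ l = τ(Qᵢ − Tᵢ) − (Qᵢ − Tᵢ)`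
    have hkey : ∀ (τ : localSubgroupOfEmb H emb) (i : Fin n), ∑ l, B i l • p (resGalSubgroupOfEmb H emb τ) l =
        (τ : absoluteGaloisGroup E) • (Q i - T i) - (Q i - T i) := by
      intro τ i
      have h1 := hτ τ i
      rw [ha', map_add, map_sub, Pi.add_apply, Pi.sub_apply, AddSubgroup.coe_add, AddSubgroup.coe_sub, map_add, map_sub,
        hBpt, hΘτ, ← hT] at h1
      rw [smul_sub, ← sub_eq_zero, ← sub_eq_zero.2 h1]
      abel
    refine ⟨_, ∑ i, B' l i • (Q i - T i), k + m, (SignedTransportAtTwo.resH1Hom_id_oneCocycleClass _ _ ψ).symm, ?_,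
      fun τ ↦ ?_⟩
    · rw [Finset.smul_sum]
      refine AddSubgroup.sum_mem _ fun i _ ↦ ?_
      rw [smul_comm, smul_sub, pow_nsmul_eq_zero_of_le (hT0 i) (Nat.le_add_left m k), sub_zero]
      exact L.nsmul_mem (pow_nsmul_mem_of_le L (hQ i) (Nat.le_add_right k m)) _
    · change pointsMapOfEmb W emb (((ψ.1 (resGalSubgroupOfEmb H emb τ) :
          ↥(AddSubgroup.torsionBy ↥(W.geomPrimaryTorsion 2) (2 : ℤ))) : ↥(W.geomPrimaryTorsion 2)) : W.geomPoints) = _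
      rw [hψ, ← hp, smul_sum_nsmul_sub]
      simp_rw [← hkey τ]
      rw [sum_nsmul_sum_nsmul, Finset.sum_congr rfl fun l' _ ↦ nsmul_eq_nsmul_of_mod_two_eq (h2 _ l')
        (b := if l = l' then 1 else 0) (by rw [hB' l l']; exact (Nat.mod_eq_of_lt (by split_ifs <;> decide)).symm)]
      simp_rw [ite_smul, one_smul, zero_smul]
      rw [Finset.sum_ite_eq, if_pos (Finset.mem_univ l)]
  · -- (⇐) from the Kummer condition on the coordinates to the transported condition on `j_* [Φ]`
    intro hW
    have hdata : ∀ l, ∃ (b : ↥(W.geomPrimaryTorsion 2)) (Q : localPoints W E) (k : ℕ), (2 ^ k) • Q ∈ L ∧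
        ∀ τ : localSubgroupOfEmb H emb, p (resGalSubgroupOfEmb H emb τ) l =
          (τ : absoluteGaloisGroup E) • (Q - pointsMapOfEmb W emb (b : W.geomPoints)) -
            (Q - pointsMapOfEmb W emb (b : W.geomPoints)) := by
      intro l
      obtain ⟨ψ, hψ, he⟩ := hecoc Φ l
      have hl := hW l
      rw [he, Kobayashi2003.mem_localKummerOverOfEmb_iff] at hl
      obtain ⟨φ', Q, k, hcl, hQ, hτ⟩ := hl
      rw [SignedTransportAtTwo.resH1Hom_id_oneCocycleClass, ← sub_eq_zero, ← oneCocycleClass_sub,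
        oneCocycleClass_eq_zero_iff] at hcl
      obtain ⟨b, hb⟩ := hcl
      refine ⟨b, Q, k, hQ, fun τ ↦ ?_⟩
      have h3 := hb (resGalSubgroupOfEmb H emb τ)
      change φ'.1 (resGalSubgroupOfEmb H emb τ) - ((ψ.1 (resGalSubgroupOfEmb H emb τ) :
          ↥(AddSubgroup.torsionBy ↥(W.geomPrimaryTorsion 2) (2 : ℤ))) : ↥(W.geomPrimaryTorsion 2)) =
        ((resGalSubgroupOfEmb H emb τ : H) : absoluteGaloisGroup K) • b - b at h3
      rw [hp, ← hψ, ← sub_sub_cancel _ ((ψ.1 (resGalSubgroupOfEmb H emb τ) :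
          ↥(AddSubgroup.torsionBy ↥(W.geomPrimaryTorsion 2) (2 : ℤ))) : ↥(W.geomPrimaryTorsion 2)), h3,
        AddSubgroup.coe_sub, AddSubgroup.coe_sub, map_sub, map_sub, hτ τ, hbτ, smul_sub]
      abel
    choose b Q k hQ hτ using hdata
    obtain ⟨m, hm⟩ := exists_pow_nsmul_eq_zero W b
    obtain ⟨T, hT⟩ : ∃ T : Fin f → localPoints W E, ∀ l, T l = pointsMapOfEmb W emb ((b l : ↥(W.geomPrimaryTorsion 2)) :
        W.geomPoints) := ⟨_, fun _ ↦ rfl⟩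
    have hT0 : ∀ l, (2 ^ m) • T l = 0 := fun l ↦ by
      rw [hT, ← map_nsmul, ← AddSubmonoidClass.coe_nsmul, hm, ZeroMemClass.coe_zero, map_zero]
    simp_rw [← hT] at hτ
    refine ⟨_, fun i ↦ ∑ l, B i l • (Q l - T l), (∑ l, k l) + m,
      (SignedTransportAtTwo.resH1Hom_id_oneCocycleClass _ _ Φ).symm, fun i ↦ ?_, fun τ i ↦ ?_⟩
    · rw [Finset.smul_sum]
      refine AddSubgroup.sum_mem _ fun l _ ↦ ?_
      have hle : k l ≤ ∑ l, k l := Finset.single_le_sum (fun _ _ ↦ Nat.zero_le _) (Finset.mem_univ l)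
      rw [smul_comm, smul_sub, pow_nsmul_eq_zero_of_le (hT0 l) (Nat.le_add_left m _), sub_zero]
      exact L.nsmul_mem (pow_nsmul_mem_of_le L (hQ l) (hle.trans (Nat.le_add_right _ m))) _
    · change pointsMapOfEmb W emb ((Θ (j (Φ.1 (resGalSubgroupOfEmb H emb τ))) i : ↥(W.geomPrimaryTorsion 2)) :
          W.geomPoints) = _
      rw [hBpt, smul_sum_nsmul_sub]
      exact Finset.sum_congr rfl fun l _ ↦ by rw [hτ l τ]

/-- **The same with `conj_σ` on both sides** (the clause as printed in the crux, for `H` normal): `conj_σ` commutes with `j_*`, with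
the push-forward to `W[2^∞]` and with the coordinates `e`. [cite: Kobayashi2003, Def. 1.1] [cite: SerreGaloisCohomology1997, I §2.2, I §5.1] -/
theorem kummer_transport_conj_iff [H.Normal]
    (hΘ : ∀ (δ : absoluteGaloisGroup E) (m : A) (i : Fin n), Θ (resGalOfEmb emb δ • m) i = resGalOfEmb emb δ • Θ m i)
    (hjsmul : ∀ (σ : absoluteGaloisGroup K) (x : Fin f → ↥(AddSubgroup.torsionBy ↥(W.geomPrimaryTorsion 2) (2 : ℤ))),
      j (σ • x) = σ • j x)
    (hB : ∀ (x : Fin f → ↥(AddSubgroup.torsionBy ↥(W.geomPrimaryTorsion 2) (2 : ℤ))) (i : Fin n),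
      Θ (j x) i = ∑ l, B i l • ((x l : ↥(AddSubgroup.torsionBy ↥(W.geomPrimaryTorsion 2) (2 : ℤ))) : ↥(W.geomPrimaryTorsion 2)))
    (hB' : ∀ l l' : Fin f, (∑ i, B' l i * B i l') % 2 = if l = l' then 1 else 0)
    (hecoc : ∀ (φ : contOneCocycles (discreteTopRep H (Fin f → ↥(AddSubgroup.torsionBy ↥(W.geomPrimaryTorsion 2) (2 : ℤ)))))
      (l : Fin f), ∃ ψ : contOneCocycles (discreteTopRep H ↥(AddSubgroup.torsionBy ↥(W.geomPrimaryTorsion 2) (2 : ℤ))),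
        (∀ h, ψ.1 h = φ.1 h l) ∧ e (oneCocycleClass _ φ) l = oneCocycleClass _ ψ)
    (heconj : ∀ (σ : absoluteGaloisGroup K)
      (x : subgroupH1 H (Fin f → ↥(AddSubgroup.torsionBy ↥(W.geomPrimaryTorsion 2) (2 : ℤ)))) (l : Fin f),
      e (conjH1 H (Fin f → ↥(AddSubgroup.torsionBy ↥(W.geomPrimaryTorsion 2) (2 : ℤ))) σ x) l =
        conjH1 H ↥(AddSubgroup.torsionBy ↥(W.geomPrimaryTorsion 2) (2 : ℤ)) σ (e x l))
    (x : subgroupH1 H (Fin f → ↥(AddSubgroup.torsionBy ↥(W.geomPrimaryTorsion 2) (2 : ℤ)))) (σ : absoluteGaloisGroup K) :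
    (∃ (φ : contOneCocycles (discreteTopRep H A)) (Q : Fin n → localPoints W E) (k : ℕ),
        oneCocycleClass (discreteTopRep H A) φ = conjH1 H A σ (pushH1 H j hjsmul x) ∧
        (∀ i : Fin n, (2 ^ k) • Q i ∈ L) ∧
        ∀ (τ : localSubgroupOfEmb H emb) (i : Fin n),
          pointsMapOfEmb W emb (((Θ (φ.1 (resGalSubgroupOfEmb H emb τ))) i : ↥(W.geomPrimaryTorsion 2)) : W.geomPoints) =
            (τ : absoluteGaloisGroup E) • Q i - Q i) ↔
      ∀ l : Fin f, W.conjH1 2 H σ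
          (pushH1 H (AddSubgroup.torsionBy ↥(W.geomPrimaryTorsion 2) (2 : ℤ)).subtype (fun _ _ ↦ rfl) (e x l)) ∈
        Kobayashi2003.localKummerOverOfEmb W 2 H emb L := by
  rw [conjH1_pushH1]
  simp_rw [WeierstrassCurve.conjH1, conjH1_pushH1, ← heconj]
  exact kummer_transport_iff W H emb L Θ j B B' e hΘ hjsmul hB hB' hecoc _

end Transport

end Summit.BirchSwinnertonDyer.BirchSwinnertonDyer.Theorems.ThetaTransport

end
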